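import Literature.Computability.AlgebraicComplexity.BorderApolarityTriplesPert
import Literature.Computability.AlgebraicComplexity.BorderApolarityMoves
import Literature.Computability.AlgebraicComplexity.BorderApolarityBorelFixed
import HarnessLib

/-!
# Borel-fixed candidate triples: degeneration and symmetry moves preserve candidates

Topic `Literature/Computability/AlgebraicComplexity`. Assembly of the elementary Borel-fixed border
apolarity theorem of Conner–Harper–Landsberg 2023 (§2.3–§2.4 with §3's tests, tri-degrees of total
degree `≤ 3`), span side, over the tree's algebraic border rank: from `BorderApolarityTriplesPert.lean`
(every approximate decomposition with `r` triads yields a candidate triple `IsCandidateTriple`),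
`BorderApolarityMoves.lean` (Kronecker moves, equivariance of the tests, lowering root elements),
`BorderApolarityBorelFixed.lean` (potential-minimal graded triples are fixed) we PROVE

* `BorderApolarity.stage_tripleInter_le`, `IsCandidateTriple.stage` — the torus degeneration
  (`WtInit.stage` in each pair space, for integer weights `eA, eB, eC` making the slices of `t`
  weight vectors) of a candidate triple is a GRADED candidate triple;
* `BorderApolarity.map_tripleInter_le`, `IsCandidateTriple.map_kronecker` — a move by `(P, Q, R)`
  leaving `t` invariant (with left inverses) maps candidate triples to candidate triples;
* `BorderApolarity.exists_borelFixed_candidateTriple` — **Borel-fixed border apolarity**: given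
  an order-`h` approximate decomposition of `t` with `r` triads and a family of `t`-invariant moves
  `(P_a, Q_a, R_a)` by unitriangular matrices lowering the weights, there is a graded candidate
  triple FIXED by every move. For `t` a matrix multiplication tensor and the moves the root
  elements of a Borel subgroup of `GL(U) × GL(V) × GL(W)` this is the normal form of CHL §2.4,
  which reduces `bR(t) ≥ r + 1` to finitely many Borel-fixed candidates failing a test.

## References

* A. Conner, A. Harper, J. M. Landsberg, *New lower bounds for matrix multiplication and `det₃`*,
  Forum Math. Pi 11 (2023) e17, arXiv:1911.07981 — §2.3, §2.4, §3. [ConnerHarperLandsberg2023]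
-/

noncomputable section

open Polynomial Matrix
open scoped Polynomial BigOperators Kronecker

namespace Literature.Computability.AlgebraicComplexity

namespace BorderApolarity

open TensorApolarity

universe u

variable {K : Type u} [Field K]
variable {ι κ μ : Type}

/-! ## Torus degeneration of the `(111)`-test space -/

section Graded

variable (eA : ι → ℕ) (eB : κ → ℕ) (eC : μ → ℕ)

/-- Integer degree of a `(111)` coordinate. [folklore] -/
def degIKM : ι × κ × μ → ℤ := fun s => ((eA s.1 + eB s.2.1 + eC s.2.2 : ℕ) : ℤ)

/-- `c`-slices of a weight projection are weight projections of slices. [folklore] -/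
theorem sliceC_projDeg (d : ℤ) (x : ι × κ × μ → K) (c : μ) :
    sliceC c (projDeg (degIKM eA eB eC) d x) = projDeg (degIK eA eB) (d - eC c) (sliceC c x) := by
  funext ab
  simp only [sliceC_apply, projDeg, LinearMap.coe_mk, AddHom.coe_mk, degIKM, degIK, wt₁]
  push_cast
  by_cases h : (eA ab.1 : ℤ) + eB ab.2 + eC c = d
  · rw [if_pos h, if_pos (by omega)]
  · rw [if_neg h, if_neg (by omega)]

/-- `a`-slices of a weight projection are weight projections of slices. [folklore] -/
theorem sliceA_projDeg (d : ℤ) (x : ι × κ × μ → K) (a : ι) :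
    sliceA a (projDeg (degIKM eA eB eC) d x) = projDeg (degIK eB eC) (d - eA a) (sliceA a x) := by
  funext bc
  simp only [sliceA_apply, projDeg, LinearMap.coe_mk, AddHom.coe_mk, degIKM, degIK, wt₁]
  push_cast
  by_cases h : (eA a : ℤ) + eB bc.1 + eC bc.2 = d
  · rw [if_pos h, if_pos (by omega)]
  · rw [if_neg h, if_neg (by omega)]

/-- `b`-slices of a weight projection are weight projections of slices. [folklore] -/
theorem sliceB_projDeg (d : ℤ) (x : ι × κ × μ → K) (b : κ) :
    sliceB b (projDeg (degIKM eA eB eC) d x) = projDeg (degIK eA eC) (d - eB b) (sliceB b x) := by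
  funext ac
  simp only [sliceB_apply, projDeg, LinearMap.coe_mk, AddHom.coe_mk, degIKM, degIK, wt₁]
  push_cast
  by_cases h : (eA ac.1 : ℤ) + eB b + eC ac.2 = d
  · rw [if_pos h, if_pos (by omega)]
  · rw [if_neg h, if_neg (by omega)]

/-- **The `(111)`-test survives the torus degeneration**: the degeneration of the test space lies
in the test space of the degenerated triple. [cite: ConnerHarperLandsberg2023, §2.4] -/
theorem stage_tripleInter_le (E₁ : Submodule K (ι × κ → K)) (E₂ : Submodule K (κ × μ → K))
    (E₃ : Submodule K (ι × μ → K)) {d₀ : ℤ} {n : ℕ}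
    (hlo₁ : ∀ p, d₀ ≤ degIK eA eB p) (hhi₁ : ∀ p, degIK eA eB p < d₀ + n)
    (hlo₂ : ∀ p, d₀ ≤ degIK eB eC p) (hhi₂ : ∀ p, degIK eB eC p < d₀ + n)
    (hlo₃ : ∀ p, d₀ ≤ degIK eA eC p) (hhi₃ : ∀ p, degIK eA eC p < d₀ + n) (e₀ : ℤ) :
    ∀ m, WtInit.stage (degIKM eA eB eC) (tripleInter E₁ E₂ E₃) e₀ m ≤
      tripleInter (WtInit.stage (degIK eA eB) E₁ d₀ n) (WtInit.stage (degIK eB eC) E₂ d₀ n)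
        (WtInit.stage (degIK eA eC) E₃ d₀ n) := by
  intro m
  induction m with
  | zero => exact bot_le
  | succ m ih =>
    rw [WtInit.stage_succ]
    refine sup_le ih ?_
    rintro _ ⟨x, ⟨hx', hxw⟩, rfl⟩
    have hx := mem_tripleInter.1 hx'
    refine mem_tripleInter.2 ⟨fun c => ?_, fun a => ?_, fun b => ?_⟩
    · rw [sliceC_projDeg]
      refine projDeg_mem_stage_window _ hlo₁ hhi₁ (hx.1 c) _ ((mem_Vge _).2 fun ab hab => ?_)
      simp only [sliceC_apply]
      exact (mem_Vge _).1 hxw (ab.1, ab.2, c) (by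
        simp only [degIKM]; simp only [degIK, wt₁] at hab; push_cast at hab ⊢; omega)
    · rw [sliceA_projDeg]
      refine projDeg_mem_stage_window _ hlo₂ hhi₂ (hx.2.1 a) _ ((mem_Vge _).2 fun bc hbc => ?_)
      simp only [sliceA_apply]
      exact (mem_Vge _).1 hxw (a, bc.1, bc.2) (by
        simp only [degIKM]; simp only [degIK, wt₁] at hbc; push_cast at hbc ⊢; omega)
    · rw [sliceB_projDeg]
      refine projDeg_mem_stage_window _ hlo₃ hhi₃ (hx.2.2 b) _ ((mem_Vge _).2 fun ac hac => ?_)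
      simp only [sliceB_apply]
      exact (mem_Vge _).1 hxw (ac.1, b, ac.2) (by
        simp only [degIKM]; simp only [degIK, wt₁] at hac; push_cast at hac ⊢; omega)

variable [Fintype ι] [Fintype κ] [Fintype μ]

/-- **The torus degeneration of a candidate triple is a candidate triple** (graded, by
`WtInit.isGraded_stage`), for weights `eA, eB, eC < W` under which the three families of slices of
`t` are weight vectors; windows `[0, 2W)` in the pair spaces. [cite: ConnerHarperLandsberg2023, §2.4] -/
theorem IsCandidateTriple.stage {r : ℕ} {t : ι → κ → μ → K} {E₁ : Submodule K (ι × κ → K)}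
    {E₂ : Submodule K (κ × μ → K)} {E₃ : Submodule K (ι × μ → K)}
    (hE : IsCandidateTriple r t E₁ E₂ E₃) {W : ℕ} (hWι : ∀ a, eA a < W) (hWκ : ∀ b, eB b < W)
    (hWμ : ∀ c, eC c < W)
    (ht₁ : ∀ c, ∃ n : ℕ, ∀ a b, t a b c ≠ 0 → eA a + eB b = n)
    (ht₂ : ∀ a, ∃ n : ℕ, ∀ b c, t a b c ≠ 0 → eB b + eC c = n)
    (ht₃ : ∀ b, ∃ n : ℕ, ∀ a c, t a b c ≠ 0 → eA a + eC c = n) :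
    IsCandidateTriple r t (WtInit.stage (degIK eA eB) E₁ 0 (W + W))
      (WtInit.stage (degIK eB eC) E₂ 0 (W + W)) (WtInit.stage (degIK eA eC) E₃ 0 (W + W)) := by
  -- windows
  have hlo₁ : ∀ p, (0 : ℤ) ≤ degIK eA eB p := fun p => by simp only [degIK]; omega
  have hhi₁ : ∀ p, degIK eA eB p < 0 + ((W + W : ℕ) : ℤ) := fun p => by
    simp only [degIK, wt₁]; have := hWι p.1; have := hWκ p.2; push_cast; omega
  have hlo₂ : ∀ p, (0 : ℤ) ≤ degIK eB eC p := fun p => by simp only [degIK]; omega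
  have hhi₂ : ∀ p, degIK eB eC p < 0 + ((W + W : ℕ) : ℤ) := fun p => by
    simp only [degIK, wt₁]; have := hWκ p.1; have := hWμ p.2; push_cast; omega
  have hlo₃ : ∀ p, (0 : ℤ) ≤ degIK eA eC p := fun p => by simp only [degIK]; omega
  have hhi₃ : ∀ p, degIK eA eC p < 0 + ((W + W : ℕ) : ℤ) := fun p => by
    simp only [degIK, wt₁]; have := hWι p.1; have := hWμ p.2; push_cast; omega
  have hloI : ∀ {α β : Type} (e : α → ℕ) (f : β → ℕ) (s : α × α × β), (0 : ℤ) ≤ degIIK e f s :=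
    fun e f s => by simp only [degIIK]; omega
  have hloK : ∀ {α β : Type} (e : α → ℕ) (f : β → ℕ) (s : α × β × β), (0 : ℤ) ≤ degIKK e f s :=
    fun e f s => by simp only [degIKK]; omega
  have hhiI : ∀ {α β : Type} (e : α → ℕ) (f : β → ℕ), (∀ a, e a < W) → (∀ b, f b < W) →
      ∀ s : α × α × β, degIIK e f s < 0 + ((W + W + W : ℕ) : ℤ) := fun e f he hf s => by
    simp only [degIIK, wt₂]; have := he s.1; have := he s.2.1; have := hf s.2.2; push_cast; omega
  have hhiK : ∀ {α β : Type} (e : α → ℕ) (f : β → ℕ), (∀ a, e a < W) → (∀ b, f b < W) →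
      ∀ s : α × β × β, degIKK e f s < 0 + ((W + W + W : ℕ) : ℤ) := fun e f he hf s => by
    simp only [degIKK, wt₃]; have := he s.1; have := hf s.2.1; have := hf s.2.2; push_cast; omega
  have hloM : ∀ s, (0 : ℤ) ≤ degIKM eA eB eC s := fun s => by simp only [degIKM]; omega
  have hhiM : ∀ s, degIKM eA eB eC s < 0 + ((W + W + W : ℕ) : ℤ) := fun s => by
    simp only [degIKM]; have := hWι s.1; have := hWκ s.2.1; have := hWμ s.2.2; push_cast; omega
  -- homogeneous slices survive
  have hslice : ∀ {α β : Type} [Fintype α] [Fintype β] (e : α → ℕ) (f : β → ℕ),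
      (∀ a, e a < W) → (∀ b, f b < W) → ∀ (E : Submodule K (α × β → K)) (x : α × β → K),
      x ∈ E → (∃ n : ℕ, ∀ p : α × β, x p ≠ 0 → e p.1 + f p.2 = n) →
      x ∈ WtInit.stage (degIK e f) E 0 (W + W) := by
    intro α β _ _ e f he hf E x hxE ⟨n, hn⟩
    by_cases hz : x = 0
    · rw [hz]; exact Submodule.zero_mem _
    · have hex : ∃ p, x p ≠ 0 := by
        by_contra hall
        push Not at hall
        exact hz (funext hall)
      obtain ⟨p₀, hp₀⟩ := hex
      have hn0 : n < W + W := by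
        rw [← hn p₀ hp₀]; have := he p₀.1; have := hf p₀.2; omega
      refine WtInit.mem_stage_of_homogeneous _ E 0 (i := n) hn0 hxE fun p hp => ?_
      simp only [degIK, wt₁, zero_add]
      exact_mod_cast hn p hp
  refine ⟨?_, ?_, ?_, fun c => ?_, fun a => ?_, fun b => ?_, ?_, ?_, ?_, ?_, ?_, ?_, ?_⟩
  · rw [WtInit.finrank_stage_eq _ E₁ hlo₁ hhi₁]; exact hE.finrank₁
  · rw [WtInit.finrank_stage_eq _ E₂ hlo₂ hhi₂]; exact hE.finrank₂
  · rw [WtInit.finrank_stage_eq _ E₃ hlo₃ hhi₃]; exact hE.finrank₃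
  · obtain ⟨n, hn⟩ := ht₁ c
    exact hslice eA eB hWι hWκ E₁ _ (hE.slice₁ c) ⟨n, fun p hp => hn p.1 p.2 hp⟩
  · obtain ⟨n, hn⟩ := ht₂ a
    exact hslice eB eC hWκ hWμ E₂ _ (hE.slice₂ a) ⟨n, fun p hp => hn p.1 p.2 hp⟩
  · obtain ⟨n, hn⟩ := ht₃ b
    exact hslice eA eC hWι hWμ E₃ _ (hE.slice₃ b) ⟨n, fun p hp => hn p.1 p.2 hp⟩
  · calc r ≤ Module.finrank K (testI E₁) := hE.testI₁
      _ = Module.finrank K (WtInit.stage (degIIK eA eB) (testI E₁) 0 (W + W + W)) :=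
          (WtInit.finrank_stage_eq _ _ (hloI eA eB) (hhiI eA eB hWι hWκ)).symm
      _ ≤ _ := Submodule.finrank_mono (stage_testI_le eA eB E₁ hlo₁ hhi₁ 0 _)
  · calc r ≤ Module.finrank K (testK E₁) := hE.testK₁
      _ = Module.finrank K (WtInit.stage (degIKK eA eB) (testK E₁) 0 (W + W + W)) :=
          (WtInit.finrank_stage_eq _ _ (hloK eA eB) (hhiK eA eB hWι hWκ)).symm
      _ ≤ _ := Submodule.finrank_mono (stage_testK_le eA eB E₁ hlo₁ hhi₁ 0 _)
  · calc r ≤ Module.finrank K (testI E₂) := hE.testI₂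
      _ = Module.finrank K (WtInit.stage (degIIK eB eC) (testI E₂) 0 (W + W + W)) :=
          (WtInit.finrank_stage_eq _ _ (hloI eB eC) (hhiI eB eC hWκ hWμ)).symm
      _ ≤ _ := Submodule.finrank_mono (stage_testI_le eB eC E₂ hlo₂ hhi₂ 0 _)
  · calc r ≤ Module.finrank K (testK E₂) := hE.testK₂
      _ = Module.finrank K (WtInit.stage (degIKK eB eC) (testK E₂) 0 (W + W + W)) :=
          (WtInit.finrank_stage_eq _ _ (hloK eB eC) (hhiK eB eC hWκ hWμ)).symm
      _ ≤ _ := Submodule.finrank_mono (stage_testK_le eB eC E₂ hlo₂ hhi₂ 0 _)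
  · calc r ≤ Module.finrank K (testI E₃) := hE.testI₃
      _ = Module.finrank K (WtInit.stage (degIIK eA eC) (testI E₃) 0 (W + W + W)) :=
          (WtInit.finrank_stage_eq _ _ (hloI eA eC) (hhiI eA eC hWι hWμ)).symm
      _ ≤ _ := Submodule.finrank_mono (stage_testI_le eA eC E₃ hlo₃ hhi₃ 0 _)
  · calc r ≤ Module.finrank K (testK E₃) := hE.testK₃
      _ = Module.finrank K (WtInit.stage (degIKK eA eC) (testK E₃) 0 (W + W + W)) :=
          (WtInit.finrank_stage_eq _ _ (hloK eA eC) (hhiK eA eC hWι hWμ)).symm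
      _ ≤ _ := Submodule.finrank_mono (stage_testK_le eA eC E₃ hlo₃ hhi₃ 0 _)
  · calc r ≤ Module.finrank K (tripleInter E₁ E₂ E₃) := hE.triple
      _ = Module.finrank K (WtInit.stage (degIKM eA eB eC) (tripleInter E₁ E₂ E₃) 0 (W + W + W)) :=
          (WtInit.finrank_stage_eq _ _ hloM hhiM).symm
      _ ≤ _ := Submodule.finrank_mono
          (stage_tripleInter_le eA eB eC E₁ E₂ E₃ hlo₁ hhi₁ hlo₂ hhi₂ hlo₃ hhi₃ 0 _)

end Graded

/-! ## Symmetry moves of candidate triples -/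

section Moves

variable [Fintype ι] [Fintype κ] [Fintype μ] [DecidableEq ι] [DecidableEq κ] [DecidableEq μ]

omit [DecidableEq ι] [DecidableEq κ] [DecidableEq μ] in
/-- **`(P ⊗ Q ⊗ R)(tripleInter E₁ E₂ E₃) ≤ tripleInter ((P ⊗ Q)E₁) ((Q ⊗ R)E₂) ((P ⊗ R)E₃)`**: every
slice of the moved array is a combination of moved slices. [cite: ConnerHarperLandsberg2023, §2.4] -/
theorem map_tripleInter_le (P : Matrix ι ι K) (Q : Matrix κ κ K) (R : Matrix μ μ K)
    (E₁ : Submodule K (ι × κ → K)) (E₂ : Submodule K (κ × μ → K)) (E₃ : Submodule K (ι × μ → K)) :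
    (tripleInter E₁ E₂ E₃).map (P ⊗ₖ (Q ⊗ₖ R)).mulVecLin ≤
      tripleInter (E₁.map (P ⊗ₖ Q).mulVecLin) (E₂.map (Q ⊗ₖ R).mulVecLin)
        (E₃.map (P ⊗ₖ R).mulVecLin) := by
  rintro _ ⟨x, hx', rfl⟩
  have hx := mem_tripleInter.1 hx'
  refine mem_tripleInter.2 ⟨fun c => ?_, fun a => ?_, fun b => ?_⟩
  · have key : sliceC c ((P ⊗ₖ (Q ⊗ₖ R)) *ᵥ x) = ∑ c', R c c' • ((P ⊗ₖ Q) *ᵥ sliceC c' x) := by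
      funext ab
      simp only [sliceC_apply, mulVec, dotProduct, Fintype.sum_prod_type, kroneckerMap_apply,
        Finset.sum_apply, Pi.smul_apply, smul_eq_mul, Finset.mul_sum]
      calc ∑ a', ∑ b', ∑ c', P ab.1 a' * (Q ab.2 b' * R c c') * x (a', b', c')
          = ∑ a', ∑ c', ∑ b', P ab.1 a' * (Q ab.2 b' * R c c') * x (a', b', c') :=
            Finset.sum_congr rfl fun a' _ => Finset.sum_comm
        _ = ∑ c', ∑ a', ∑ b', P ab.1 a' * (Q ab.2 b' * R c c') * x (a', b', c') := Finset.sum_comm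
        _ = _ := Finset.sum_congr rfl fun c' _ => Finset.sum_congr rfl fun a' _ =>
            Finset.sum_congr rfl fun b' _ => by ring
    rw [mulVecLin_apply, key]
    exact Submodule.sum_mem _ fun c' _ => Submodule.smul_mem _ _ ⟨sliceC c' x, hx.1 c', rfl⟩
  · have key : sliceA a ((P ⊗ₖ (Q ⊗ₖ R)) *ᵥ x) = ∑ a', P a a' • ((Q ⊗ₖ R) *ᵥ sliceA a' x) := by
      funext bc
      simp only [sliceA_apply, mulVec, dotProduct, Fintype.sum_prod_type, kroneckerMap_apply,
        Finset.sum_apply, Pi.smul_apply, smul_eq_mul, Finset.mul_sum]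
      exact Finset.sum_congr rfl fun a' _ => Finset.sum_congr rfl fun b' _ =>
        Finset.sum_congr rfl fun c' _ => by ring
    rw [mulVecLin_apply, key]
    exact Submodule.sum_mem _ fun a' _ => Submodule.smul_mem _ _ ⟨sliceA a' x, hx.2.1 a', rfl⟩
  · have key : sliceB b ((P ⊗ₖ (Q ⊗ₖ R)) *ᵥ x) = ∑ b', Q b b' • ((P ⊗ₖ R) *ᵥ sliceB b' x) := by
      funext ac
      simp only [sliceB_apply, mulVec, dotProduct, Fintype.sum_prod_type, kroneckerMap_apply,
        Finset.sum_apply, Pi.smul_apply, smul_eq_mul, Finset.mul_sum]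
      calc ∑ a', ∑ b', ∑ c', P ac.1 a' * (Q b b' * R ac.2 c') * x (a', b', c')
          = ∑ b', ∑ a', ∑ c', P ac.1 a' * (Q b b' * R ac.2 c') * x (a', b', c') := Finset.sum_comm
        _ = _ := Finset.sum_congr rfl fun b' _ => Finset.sum_congr rfl fun a' _ =>
            Finset.sum_congr rfl fun c' _ => by ring
    rw [mulVecLin_apply, key]
    exact Submodule.sum_mem _ fun b' _ => Submodule.smul_mem _ _ ⟨sliceB b' x, hx.2.2 b', rfl⟩

omit [DecidableEq ι] [DecidableEq κ] [DecidableEq μ] in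
/-- Invariance of `t` under `(P, Q, R)` read with the slots rotated. [folklore] -/
theorem invariant_rotate {P : Matrix ι ι K} {Q : Matrix κ κ K} {R : Matrix μ μ K}
    {t : ι → κ → μ → K}
    (hinv : ∀ a b c, ∑ a', ∑ b', ∑ c', P a a' * Q b b' * R c c' * t a' b' c' = t a b c) (b : κ)
    (c : μ) (a : ι) :
    ∑ b', ∑ c', ∑ a', Q b b' * R c c' * P a a' * t a' b' c' = t a b c := by
  rw [← hinv a b c]
  calc ∑ b', ∑ c', ∑ a', Q b b' * R c c' * P a a' * t a' b' c'
      = ∑ b', ∑ a', ∑ c', Q b b' * R c c' * P a a' * t a' b' c' :=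
        Finset.sum_congr rfl fun b' _ => Finset.sum_comm
    _ = ∑ a', ∑ b', ∑ c', Q b b' * R c c' * P a a' * t a' b' c' := Finset.sum_comm
    _ = _ := Finset.sum_congr rfl fun a' _ => Finset.sum_congr rfl fun b' _ =>
        Finset.sum_congr rfl fun c' _ => by ring

omit [DecidableEq ι] [DecidableEq κ] [DecidableEq μ] in
/-- Invariance of `t` under `(P, Q, R)` read with the last two slots swapped. [folklore] -/
theorem invariant_swap {P : Matrix ι ι K} {Q : Matrix κ κ K} {R : Matrix μ μ K}
    {t : ι → κ → μ → K}
    (hinv : ∀ a b c, ∑ a', ∑ b', ∑ c', P a a' * Q b b' * R c c' * t a' b' c' = t a b c) (a : ι)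
    (c : μ) (b : κ) :
    ∑ a', ∑ c', ∑ b', P a a' * R c c' * Q b b' * t a' b' c' = t a b c := by
  rw [← hinv a b c]
  refine Finset.sum_congr rfl fun a' _ => ?_
  rw [Finset.sum_comm]
  exact Finset.sum_congr rfl fun b' _ => Finset.sum_congr rfl fun c' _ => by ring

/-- **A `t`-invariant move maps candidate triples to candidate triples.**
[cite: ConnerHarperLandsberg2023, §2.4] -/
theorem IsCandidateTriple.map_kronecker {r : ℕ} {t : ι → κ → μ → K} {E₁ : Submodule K (ι × κ → K)}
    {E₂ : Submodule K (κ × μ → K)} {E₃ : Submodule K (ι × μ → K)}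
    (hE : IsCandidateTriple r t E₁ E₂ E₃) {P P' : Matrix ι ι K} {Q Q' : Matrix κ κ K}
    {R R' : Matrix μ μ K} (hP : P' * P = 1) (hQ : Q' * Q = 1) (hR : R' * R = 1)
    (hinv : ∀ a b c, ∑ a', ∑ b', ∑ c', P a a' * Q b b' * R c c' * t a' b' c' = t a b c) :
    IsCandidateTriple r t (E₁.map (P ⊗ₖ Q).mulVecLin) (E₂.map (Q ⊗ₖ R).mulVecLin)
      (E₃.map (P ⊗ₖ R).mulVecLin) := by
  refine ⟨(Submodule.finrank_map_le _ _).trans hE.finrank₁,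
    (Submodule.finrank_map_le _ _).trans hE.finrank₂,
    (Submodule.finrank_map_le _ _).trans hE.finrank₃,
    slice_mem_map_of_invariant P Q R t hinv hE.slice₁,
    slice_mem_map_of_invariant Q R P (fun b c a => t a b c) (invariant_rotate hinv) hE.slice₂,
    slice_mem_map_of_invariant P R Q (fun a c b => t a b c) (invariant_swap hinv) hE.slice₃,
    hE.testI₁.trans (finrank_testI_le_map hP hQ E₁), hE.testK₁.trans (finrank_testK_le_map hP hQ E₁),
    hE.testI₂.trans (finrank_testI_le_map hQ hR E₂), hE.testK₂.trans (finrank_testK_le_map hQ hR E₂),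
    hE.testI₃.trans (finrank_testI_le_map hP hR E₃), hE.testK₃.trans (finrank_testK_le_map hP hR E₃),
    hE.triple.trans ?_⟩
  have hinj : Function.Injective (P ⊗ₖ (Q ⊗ₖ R)).mulVecLin :=
    mulVecLin_injective_of_mul_eq_one
      (kronecker_mul_kronecker_eq_one hP (kronecker_mul_kronecker_eq_one hQ hR))
  calc Module.finrank K (tripleInter E₁ E₂ E₃)
      = Module.finrank K ((tripleInter E₁ E₂ E₃).map (P ⊗ₖ (Q ⊗ₖ R)).mulVecLin) :=
        (LinearEquiv.finrank_eq (Submodule.equivMapOfInjective _ hinj _)).symm.symm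
    _ ≤ _ := Submodule.finrank_mono (map_tripleInter_le P Q R E₁ E₂ E₃)

end Moves

/-! ## Borel-fixed border apolarity -/

section Borel

variable [Fintype ι] [Fintype κ] [Fintype μ] [DecidableEq ι] [DecidableEq κ] [DecidableEq μ]

/-- **Borel-fixed border apolarity (elementary, span side).** Let `t` have an order-`h` approximate
decomposition with `r` triads, `r` at most the number of available coordinate triples with
pairwise-injective projections `(pa, pb, pc)`. Let `eA, eB, eC < W` be integer weights making the
three families of slices of `t` weight vectors, and let `(P_a, Q_a, R_a)` be `t`-invariant moves by
unitriangular matrices LOWERING the weights, with left inverses. Then there is a GRADED candidate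
triple `(E₁, E₂, E₃)` FIXED by every move: `(P_a ⊗ Q_a)E₁ = E₁`, `(Q_a ⊗ R_a)E₂ = E₂`,
`(P_a ⊗ R_a)E₃ = E₃`. [cite: ConnerHarperLandsberg2023, §2.4] -/
theorem exists_borelFixed_candidateTriple {r h : ℕ} {t : ι → κ → μ → K}
    {u : Fin r → ι → K[X]} {v : Fin r → κ → K[X]} {w : Fin r → μ → K[X]}
    (hd : IsApproxDecomposition h t u v w) (pa : Fin r → ι) (pb : Fin r → κ) (pc : Fin r → μ)
    (hAB : Function.Injective fun ρ => (pa ρ, pb ρ))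
    (hBC : Function.Injective fun ρ => (pb ρ, pc ρ))
    (hAC : Function.Injective fun ρ => (pa ρ, pc ρ))
    (eA : ι → ℕ) (eB : κ → ℕ) (eC : μ → ℕ) {W : ℕ} (hWι : ∀ a, eA a < W) (hWκ : ∀ b, eB b < W)
    (hWμ : ∀ c, eC c < W)
    (ht₁ : ∀ c, ∃ n : ℕ, ∀ a b, t a b c ≠ 0 → eA a + eB b = n)
    (ht₂ : ∀ a, ∃ n : ℕ, ∀ b c, t a b c ≠ 0 → eB b + eC c = n)
    (ht₃ : ∀ b, ∃ n : ℕ, ∀ a c, t a b c ≠ 0 → eA a + eC c = n)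
    {ι' : Type*} (P P' : ι' → Matrix ι ι K) (Q Q' : ι' → Matrix κ κ K) (R R' : ι' → Matrix μ μ K)
    (hP : ∀ i, P' i * P i = 1) (hQ : ∀ i, Q' i * Q i = 1) (hR : ∀ i, R' i * R i = 1)
    (hPl : ∀ i, IsLoweringUnitriangular eA (P i)) (hQl : ∀ i, IsLoweringUnitriangular eB (Q i))
    (hRl : ∀ i, IsLoweringUnitriangular eC (R i))
    (hinv : ∀ i a b c, ∑ a', ∑ b', ∑ c', P i a a' * Q i b b' * R i c c' * t a' b' c' = t a b c) :
    ∃ (E₁ : Submodule K (ι × κ → K)) (E₂ : Submodule K (κ × μ → K))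
      (E₃ : Submodule K (ι × μ → K)), IsCandidateTriple r t E₁ E₂ E₃ ∧
      WtInit.IsGraded (degIK eA eB) E₁ ∧ WtInit.IsGraded (degIK eB eC) E₂ ∧
      WtInit.IsGraded (degIK eA eC) E₃ ∧
      ∀ i, E₁.map (P i ⊗ₖ Q i).mulVecLin = E₁ ∧ E₂.map (Q i ⊗ₖ R i).mulVecLin = E₂ ∧
        E₃.map (P i ⊗ₖ R i).mulVecLin = E₃ := by
  have hlo₁ : ∀ p, (0 : ℤ) ≤ degIK eA eB p := fun p => by simp only [degIK]; omega
  have hhi₁ : ∀ p, degIK eA eB p < 0 + ((W + W : ℕ) : ℤ) := fun p => by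
    simp only [degIK, wt₁]; have := hWι p.1; have := hWκ p.2; push_cast; omega
  have hlo₂ : ∀ p, (0 : ℤ) ≤ degIK eB eC p := fun p => by simp only [degIK]; omega
  have hhi₂ : ∀ p, degIK eB eC p < 0 + ((W + W : ℕ) : ℤ) := fun p => by
    simp only [degIK, wt₁]; have := hWκ p.1; have := hWμ p.2; push_cast; omega
  have hlo₃ : ∀ p, (0 : ℤ) ≤ degIK eA eC p := fun p => by simp only [degIK]; omega
  have hhi₃ : ∀ p, degIK eA eC p < 0 + ((W + W : ℕ) : ℤ) := fun p => by
    simp only [degIK, wt₁]; have := hWι p.1; have := hWμ p.2; push_cast; omega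
  obtain ⟨E₁, E₂, E₃, hE⟩ := exists_candidateTriple_of_isApproxDecomposition hd pa pb pc hAB hBC hAC
  have hex : ∃ E₁ E₂ E₃, IsCandidateTriple r t E₁ E₂ E₃ ∧ WtInit.IsGraded (degIK eA eB) E₁ ∧
      WtInit.IsGraded (degIK eB eC) E₂ ∧ WtInit.IsGraded (degIK eA eC) E₃ :=
    ⟨_, _, _, hE.stage eA eB eC hWι hWκ hWμ ht₁ ht₂ ht₃, WtInit.isGraded_stage _ _,
      WtInit.isGraded_stage _ _, WtInit.isGraded_stage _ _⟩
  exact WtInit.exists_fixed_triple (degIK eA eB) (degIK eB eC) (degIK eA eC)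
    (fun i => (P i ⊗ₖ Q i).mulVecLin) (fun i => (Q i ⊗ₖ R i).mulVecLin)
    (fun i => (P i ⊗ₖ R i).mulVecLin)
    (fun i => isLowering_kronecker (hPl i) (hQl i)) (fun i => isLowering_kronecker (hQl i) (hRl i))
    (fun i => isLowering_kronecker (hPl i) (hRl i))
    (fun E₁ E₂ E₃ => IsCandidateTriple r t E₁ E₂ E₃) hlo₁ hhi₁ hlo₂ hhi₂ hlo₃ hhi₃ hex
    (fun E₁ E₂ E₃ hE' _ _ _ i => (hE'.map_kronecker (hP i) (hQ i) (hR i) (hinv i)).stage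
      eA eB eC hWι hWκ hWμ ht₁ ht₂ ht₃)

end Borel

end BorderApolarity

end Literature.Computability.AlgebraicComplexity

end
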